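import Summits.ResolutionOfSingularities.ResolutionOfSingularities.Theorems.PurelyInseparableDim4E2DirectrixPresentation
import Summits.ResolutionOfSingularities.ResolutionOfSingularities.Theorems.PurelyInseparableDim4RidgeDirectrix
import Summits.ResolutionOfSingularities.ResolutionOfSingularities.Theorems.PurelyInseparableDim4E2OfCJSStatus
import Mathlib.FieldTheory.IsAlgClosed.AlgebraicClosure
import HarnessLib

/-!
# Sub-row (E) «DIRECTRIX» of the E2(3,3) dictionary DISCHARGED: `E2OfCJS.DirectrixRow` holds (cell `res-dim4-pi`)

[OURS · counted 0 · the composition of this seat's STALK half (`E2Directrix.exists_directrix_presentation`: `e_x`, `ē_x` of a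
point presented by `𝒪_{𝔸⁵,0}/(z³ + F)` are the directrix dimensions of the cone `z³ + in₃ F` along a bijective residue map) with
seat p-5 g2's POLYNOMIAL half (`RidgeDirectrix.directrixDim_span_map_hyp_initialForm`, p665129: `e((z^p + in F) ⊗ K) = ebar F`
over every perfect `K`); nothing here is a statement of any manuscript and nothing here proves the remaining rows (M-b), (M-c),
(I), E2(3,3), `NoIsolatedTrap 3 3` or resolution of singularities in dimension ≥ 4 / characteristic `p`.]

* `perfectRing_of_bijective` — a field receiving a bijective homomorphism from a perfect field of characteristic `p` is perfect.
* `dirDim_eq_ebar_of_stalk_iso_hypStalk` — the content form over `p`: `e_x = ē(F)` and `ē_x = ē(F)` for every point presented by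
  `𝒪_{𝔸⁵_L,ξ}/(z^p + F)`, `L` perfect of characteristic `p`, `ord₀ F = p`.
* **`E2OfCJS.directrixRow : DirectrixRow`** (p = 3), and the conditional of record with (N), (E), (X) discharged:
  `NoIsolatedTrap 3 3 ⟸ [CJS Thm 6.40, named fact] ∧ LocalizationRow ∧ IsolationRow`
  (`noIsolatedTrap_three_three_of_CJS_of_localization_isolation`).

bears_on: LADDER-RESOLUTION:D157-DOOR2 (res-dim4-pi · F4-I(3,3) · E2 dictionary row (E) ✓).  Seat res-dim4-p-1 g2.
Supports stmt-ResolutionOfSingularities-16155 (helper).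
-/

set_option linter.dupNamespace false

noncomputable section

open CategoryTheory AlgebraicGeometry IsLocalRing MvPolynomial
open Literature.AlgebraicGeometry.Resolution Scheme.IdealSheafData
open Literature.AlgebraicGeometry.Resolution.Hauser2010
open Literature.AlgebraicGeometry.Resolution.HauserPerlega2019
open Literature.RingTheory.MvPolynomial

namespace Summit.ResolutionOfSingularities.ResolutionOfSingularities.Theorems.PIDim4

namespace E2Directrix

open AffinePointBlowup (P ξ)

/-- A field receiving a BIJECTIVE homomorphism from a perfect field of characteristic `p` is perfect (its Frobenius is onto).
[folklore] -/
theorem perfectRing_of_bijective (p : ℕ) [Fact p.Prime] {L K : Type} [Field L] [CharP L p] [PerfectRing L p] [Field K]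
    [CharP K p] (θ : L →+* K) (hθ : Function.Bijective θ) : PerfectRing K p := by
  refine PerfectRing.ofSurjective K p fun z => ?_
  obtain ⟨l, rfl⟩ := hθ.2 z
  obtain ⟨l', rfl⟩ := (bijective_frobenius L p).2 l
  exact ⟨θ l', by rw [frobenius_def, frobenius_def, map_pow]⟩

/-- **Row (E), content form (every prime `p`).**  For a perfect field `L` of characteristic `p`, `F ∈ L[x₁..x₄]` with
`ord₀ F = p`, and a point `y` of a locally Noetherian scheme `Y` whose local ring is isomorphic to
`𝒪_{𝔸⁵_L,ξ} ⧸ stalkIdeal (hypSheaf p F) ξ`: `e_y(Y) = ē(F)` and `ē_y(Y) = ē(F)`, `ē(F) = RidgeBudget.ebar F = dim_L A(in_p F)`.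
[OURS · row (E)] [cite: CossartJannsenSaito2020, Def. 2.18, Def. 2.21 and Def. 2.26] -/
theorem dirDim_eq_ebar_of_stalk_iso_hypStalk (p : ℕ) [hp : Fact p.Prime] {L : Type} [Field L] [CharP L p]
    [PerfectRing L p] (F : MvPolynomial (Fin 4) L) (hF : ordZero F = p) {Y : Scheme.{0}} [IsLocallyNoetherian Y] (y : Y)
    (eX : Y.presheaf.stalk y ≅
      CommRingCat.of ((P 4 L).presheaf.stalk (ξ 4 L) ⧸ stalkIdeal (hypSheaf p F) (ξ 4 L))) :
    Scheme.dirDim Y y = RidgeBudget.ebar F ∧ Scheme.geomDirDim Y y = RidgeBudget.ebar F := by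
  obtain ⟨θ, hθ, hdir, hgeom⟩ := exists_directrix_presentation p F hF y eX
  haveI hcharκ : CharP (ResidueField (Y.presheaf.stalk y)) p := charP_of_injective_ringHom hθ.1 p
  constructor
  · letI : Algebra L (ResidueField (Y.presheaf.stalk y)) := θ.toAlgebra
    haveI : PerfectRing (ResidueField (Y.presheaf.stalk y)) p := perfectRing_of_bijective p θ hθ
    rw [hdir]
    exact RidgeDirectrix.directrixDim_span_map_hyp_initialForm p hF
  · letI : Algebra L (AlgebraicClosure (ResidueField (Y.presheaf.stalk y))) :=
      ((algebraMap (ResidueField (Y.presheaf.stalk y)) (AlgebraicClosure (ResidueField (Y.presheaf.stalk y)))).comp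
        θ).toAlgebra
    haveI : CharP (AlgebraicClosure (ResidueField (Y.presheaf.stalk y))) p :=
      charP_of_injective_ringHom
        (algebraMap (ResidueField (Y.presheaf.stalk y)) (AlgebraicClosure (ResidueField (Y.presheaf.stalk y)))).injective p
    rw [hgeom]
    exact RidgeDirectrix.directrixDim_span_map_hyp_initialForm p hF

end E2Directrix

namespace E2OfCJS

open Literature.AlgebraicGeometry.CossartJannsenSaito2020

/-- **Row (E) DIRECTRIX holds**: a point presented over a perfect field of characteristic `3` by `F` of order exactly `3`
has `e = ē = ebar F`. [OURS · row (E) ✓] [cite: CossartJannsenSaito2020, Def. 2.18, Def. 2.21 and Def. 2.26] -/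
theorem directrixRow : DirectrixRow := by
  intro L _ _ _ F hF X _ x hX
  haveI : Fact (Nat.Prime 3) := ⟨Nat.prime_three⟩
  obtain ⟨eX⟩ := hX
  exact E2Directrix.dirDim_eq_ebar_of_stalk_iso_hypStalk 3 F (by exact_mod_cast hF) x eX

/-- **F4-I(3,3) from CJS with rows (N), (E), (X) discharged and (M) reduced to (M-b)**: `NoIsolatedTrap 3 3` follows from CJS
Thm. 6.40 (localised, isolated; named fact) and the two remaining OURS rows — localisation (M-b) and isolation (I).
[OURS · conditional] [cite: CossartJannsenSaito2020, Thm. 6.40] -/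
theorem noIsolatedTrap_three_three_of_CJS_of_localization_isolation
    (hK640 : KeyTheorem640_char_localized_isolated.{0}) (hMb : LocalizationRow) (hI : IsolationRow) :
    NoIsolatedTrap 3 3 :=
  noIsolatedTrap_three_three_of_CJS_status hK640 hMb directrixRow hI

end E2OfCJS

end Summit.ResolutionOfSingularities.ResolutionOfSingularities.Theorems.PIDim4

end
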